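import Mathlib.Analysis.Fourier.FourierTransform
import Mathlib.LinearAlgebra.Basis.SMul
import Literature.Algebra.EuclideanLattices.DualLattice
import Literature.Algebra.EuclideanLattices.SuccessiveMinima
import Literature.MathematicalPhysics.StatisticalMechanics.Crystallization
import HarnessLib

/-!
# Barrier: Sütő's Fourier-positive potentials — degenerate (incl. aperiodic) ground states in `ℝ³`

Topic: `Literature/Barriers/AtomisticToContinuum` (barrier catalogue of
`AtomisticToContinuum/Crystallization`, D-0021).

## The result, as printed

Sütő 2006 (Phys. Rev. B 74, 104117 = arXiv:math-ph/0608041), §2. *Definition.* "`X` is a `μ`GSC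
(respectively, `X` is a GSC) if for any finite part `X_f` of `X` and any finite `R` (respectively,
any `R` such that `N_R = N_{X_f}`) `U(R|X∖X_f) − μN_R ≥ U(X_f|X∖X_f) − μN_{X_f}`", where
`U(R) = ½ ∑_{r ≠ r' ∈ R} φ(r − r')`, `I(R, X) = ∑_{r ∈ R} ∑_{x ∈ X} φ(r − x)`,
`U(R|X) = U(R) + I(R, X)`; "If `X` is an infinite configuration, the infinite sum … has to be
convergent … one may ask `I(R,X)` to be finite for every `X` that is locally uniformly finite …
the corresponding condition on the interaction is strong temperedness which for a bounded `φ`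
reads `∑_{x ∈ X} |φ(x)| < ∞` for any locally uniformly finite `X`" (Sütő 2011, Definition 7.1,
makes the absolute convergence of `I(X_f, X ∖ X_f)` part of the definition; strong
temperedness is `|u(x)| ≤ C|x|^{-d-η}` for `|x| > r₀`, ibid. (2.2)).

*THEOREM.* "Let `φ̂ ∈ L¹(ℝᵈ)` be a real function with the following properties: (1) `φ̂` is
continuous at the origin, (2) `φ̂(−k) = φ̂(k)`, (3) `φ̂ ≥ 0` and (4) there is some `K₀` such
that `φ̂(k) = 0` for `|k| > K₀`. (i) Define `φ(r) = (2π)^{-d} ∫ φ̂(k) e^{ik·r} dk`. Choose Bravais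
lattices `B₁, …, B_J` such that each `q_{B_j^*} ≥ K₀`, where equality is allowed only if `φ̂` is
continuous at `|k| = K₀`. Then `X = ∪_{j=1}^J (B_j + y_j)` is a GSC of `φ` for arbitrary
translations `y_j` and it is also a `μ`GSC for `μ = ρ(X)φ̂(0) − ½φ(0)`. The energy per unit
volume of `X` is `e(X) = ε(ρ(X))` where `ε(ρ) = ½ρ[ρφ̂(0) − φ(0)]` is the minimum of the energy
density among unions of periodic configurations of density `ρ`. GSCs of the above properties
exist in a semi-infinite density interval `[ρ_d, ∞)`." Here `B^* = {∑ n_α b_α}` with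
`a_α · b_β = 2πδ_{αβ}` and `q_{B^*}` is its nearest-neighbour distance (the length of the
shortest non-zero vector). Remark 2: "`ρ₃ = K₀³/8√2π³` and the lattice is the bcc one … in the
interval `nρ_d ≤ ρ < (n+1)ρ_d` the ground state configurations are unions of at most `n`
Bravais lattices, each of density `≥ ρ_d`. Thus, the simplest aperiodic GSCs, unions of two
incommensurate Bravais lattices, appear only if `ρ ≥ 2ρ_d`. For example, in 3 dimensions at
`2ρ₃` they are the unions of two bcc lattices rotated and possibly shifted with respect to each
other." Remark 3: "The family of all the GSCs of `φ` above the density `ρ_d` is closed on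
unions." Remark 6: "A sufficient condition for `φ` to be strongly tempered is that
`|φ(r)| ≤ Cr^{-d-η}` for `r > r'` … this holds, for example, if besides conditions (1)-(4), `φ̂`
is 3 times differentiable". The 2005 announcement (Phys. Rev. Lett. 95, 265501), abstract:
"A typical three dimensional example is an interaction of asymptotic form `cos K₀r/r⁴` … For
`ρ > ρ_d` the GSC is non-unique and the degeneracy is continuous: Any periodic configuration of
density `ρ` with all reciprocal lattice vectors not smaller than `K₀`, and any union of such
configurations, is a GSC" (the same in THEOREM (i)–(ii) there); closing summary paragraph:
"ground states of innocent looking RKKY-type interactions such as `cos K₀r/r⁴` are continuously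
deformable by volume preserving transformations without cost of energy".

Flatley–Theil 2015, §1 (Introduction, fifth paragraph), on these results: "To our best knowledge, the first
three-dimensional examples for which the existence of periodic minimizers can be guaranteed are
due to A. Suto … However, the potentials are very delocalized resulting in a significantly
degenerate behavior of the ground states: every periodic configuration with a sufficiently high
density is a minimizer."

## What is formalised

* `Suto.energy`, `Suto.interaction`, `Suto.IsGSC` — `U(R)`, `I(R, X)` and the (canonical) GSC
  property in the second ("equivalent") form of Sütő's definition, for finite configurations
  `R : Fin N → ℝᵈ` (sequences: coincident points allowed, as in print) and an infinite
  configuration given as a point SET `X ⊆ ℝᵈ`, with the standing absolute-convergence convention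
  made part of the definition (`∀ r, Summable (x ↦ φ(r − x))` over `X`; Sütő 2006 (abssum),
  Sütő 2011 Def. 7.1).
* `Suto.potential ψ = Re 𝓕⁻¹ψ` in MATHLIB's convention `𝓕⁻¹ψ(r) = ∫ ψ(w) e^{2πi⟨w,r⟩} dw`;
  dictionary: `ψ(w) = φ̂(2πw)`, `κ = K₀/2π`, so `B^* = 2π · (Literature.Lattice.dualLattice B)` and
  `q_{B^*} ≥ K₀` becomes: every non-zero `w` of the tree's dual lattice
  `Literature.Lattice.dualLattice B = {w | ∀ g ∈ B, ⟨w, g⟩ ∈ ℤ}` has `‖w‖ ≥ κ`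
  (`Suto.DualVectorsAtLeast κ B`; equivalently `κ ≤ Literature.Lattice.minNorm (dualLattice B)`,
  `dualVectorsAtLeast_iff_le_minNorm`).
* `Suto.IsAdmissible κ ψ` — THE TECHNIQUE-CLASS SCOPE, a sub-class of the printed hypotheses:
  `ψ` continuous (so (1) holds, `ψ ∈ L¹`, and equality `q = K₀` is allowed), `ψ ≥ 0`, even,
  `ψ(w) = 0` for `‖w‖ > κ`, `κ > 0`, AND `φ = Suto.potential ψ` strongly tempered
  (`|φ(r)| ≤ C‖r‖^{-(d+η)}` beyond some radius; Remark 6), so that every lattice sum converges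
  absolutely and Sütő's Gauss–Abel interpretation (Poisson-Abel) of `I(r, B)` is not needed.
* `SutoDegenerateGroundStates` — NAMED FACT, DISCHARGED in the companion
  `SutoDegenerateGroundStatesProofs.lean` (`SutoDegenerateGroundStates_holds`, by the tree's
  lattice Poisson summation formula): clause "X is a GSC" of
  THEOREM (i), for finite unions of periodic configurations of the tree
  (`Literature.StatMech.PeriodicConfiguration d` = lattice `B_j` with `q`-condition + finite motif =
  the source's "`B_j`-periodic configuration") with pairwise disjoint point sets (so that the
  union, as a SET, is the printed configuration, which is a sequence). Weaker than print exactly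
  in: the sub-class `IsAdmissible`; disjointness; the `μ`GSC clause, the energy-density formula
  `ε(ρ)` and the existence interval `[ρ_d, ∞)` are quoted above but not formalised.
* PROVED: `SutoDegenerateGroundStates.periodic` / `.translate` (cases `J = 1`: every
  admissible periodic configuration, every translate `y + B`);
  `dualVectorsAtLeast_cubicLattice` (the simple cubic lattice `cℤ³`, `0 < c ≤ 1/κ`, satisfies
  the reciprocal condition — Sütő 2005 (ii): sc is a GSC at and above
  `ρ_sc = (1/8)(K₀/π)³ = κ³`), whence `SutoDegenerateGroundStates.cubic`: given the fact, for
  every admissible `(κ, ψ)` ALL translates `y + cℤ³`, `0 < c ≤ κ⁻¹`, are ground state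
  configurations of the same interaction — a two-parameter continuum in `d = 3`.
* NARROWED (barrier audit 2026-08-15): `SutoDegenerateGroundStatesNarrow.lean`, entry
  `SutoDegenerateGroundStatesNarrow` (proved). The degeneracy is a PRESCRIBED-density
  (`ρ > ρ_d`) / prescribed-`μ` phenomenon: on the family the energy per particle is
  `ε(ρ)/ρ = ½[ρφ̂(0) − φ(0)]`, strictly increasing in `ρ` when `φ̂(0) > 0` (superstable), so at
  ZERO PRESSURE (minimal energy per particle — the `E(N)` problem of `Crystallization`) no
  degenerate member competes and the family's minimiser is the threshold lattice alone (bcc at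
  `ρ₃`); only on the non-superstable edge `φ̂(0) = 0` is the whole family degenerate at zero
  pressure. That file also certifies two non-zero members of `Suto.IsAdmissible`
  (`plateauProfile`, `annulusProfile`). See `scope_caveats` (d)–(e) below.

## Search note

No ground-state-configuration (local stability of infinite configurations) notion exists in
Mathlib or in `Literature/` (`lean search 'GSC|GroundStateConfig|IsLocallyStable|tempered'`);
the tree's `Literature.MathematicalPhysics.StatisticalMechanics.groundStateEnergy`/`IsGroundState` (`Crystallization.lean`) are the
finite-`N` zero-pressure notions for radial `V`, a different object. Reused from the tree:
periodic configurations `Literature.MathematicalPhysics.StatisticalMechanics.PeriodicConfiguration` (`Crystallization.lean`), the dual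
lattice `Literature.Algebra.EuclideanLattices.dualLattice` / `mem_dualLattice` (`DualLattice.lean`) and the minimum distance
`Literature.Algebra.EuclideanLattices.minNorm` (`SuccessiveMinima.lean`) for `q_{B^*}`; the Fourier transform is Mathlib's
`𝓕⁻`; no lattice Poisson summation formula exists in Mathlib/Literature (hence a named fact).

## References (read at the cited places)

* A. Sütő, Phys. Rev. Lett. 95 (2005) 265501 (arXiv:math-ph/0508004): abstract, THEOREM
  (i)–(iii), proof (pp. 2–5 of the arXiv version).
* A. Sütő, Phys. Rev. B 74 (2006) 104117 (arXiv:math-ph/0608041): §2, Definition, THEOREM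
  (i)–(iii), Remarks 1–7 (pp. 5–8).
* A. Sütő, Comm. Math. Phys. 305 (2011) 657–710 (arXiv:1004.5260): (2.2), Definitions 7.1–7.2,
  Lemma 7.1.
* L. Flatley, F. Theil, ARMA 218 (2015) 363–416 (arXiv:1407.0692), §1 (Introduction, fifth
  paragraph).
* X. Blanc, M. Lewin, EMS Surv. Math. Sci. 2 (2015), §1.3 (stability of `V₁ + V₂` with `V₁ ≥ 0`,
  `V̂₂ ≥ 0`, via `∑_{i<j} V₂ = ½(2π)^{-d/2}∫ V̂₂(k)|∑_j e^{ik·x_j}|² dk − (N/2)V₂(0)`).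
-/

noncomputable section

open scoped RealInnerProductSpace Pointwise FourierTransform
open MeasureTheory

namespace Literature.Barriers.AtomisticToContinuum

namespace Suto

variable {d : ℕ}

/-- The energy `U(R) = ½ ∑_{i ≠ j} φ(r_i − r_j)` of a finite configuration `R = (r_1, …, r_N)`
(a sequence: coincident points are allowed and counted with repetition).
[cite: Suto2006, §2 (definition of U(R))] -/
def energy (φ : EuclideanSpace ℝ (Fin d) → ℝ) {N : ℕ} (r : Fin N → EuclideanSpace ℝ (Fin d)) :
    ℝ :=
  (1 / 2) * ∑ i, ∑ j ∈ Finset.univ.filter (· ≠ i), φ (r i - r j)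

/-- The interaction energy `I(R, X) = ∑_{r ∈ R} ∑_{x ∈ X} φ(r − x)` of a finite configuration `R`
with a configuration `X` (an unconditional sum over the point set `X`).
[cite: Suto2006, §2 (definition of I(R,X))] -/
def interaction (φ : EuclideanSpace ℝ (Fin d) → ℝ) {N : ℕ} (r : Fin N → EuclideanSpace ℝ (Fin d))
    (X : Set (EuclideanSpace ℝ (Fin d))) : ℝ :=
  ∑ i, ∑' x : X, φ (r i - x)

/-- **Ground state configuration (GSC)**, canonical version, in the second ("seemingly more
general, but actually equivalent") form of Sütő's definition: `X` is a GSC of `φ` if for every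
finite part `X_f ⊆ X` (here: `N` distinct points `x_f : Fin N ↪ X`) and every finite
configuration `R` with `N_R = N_{X_f}`,
`U(R) + I(R, X ∖ X_f) ≥ U(X_f) + I(X_f, X ∖ X_f)` — "no local modification can decrease its
energy". The first conjunct is the standing convergence convention of the source made explicit
(Sütő 2006, §2: "`∑_{x ∈ X} |φ(x)| < ∞` for any locally uniformly finite `X`"; Sütő 2011,
Definition 7.1: "the sum `I(X_f, X ∖ X_f)` is absolutely convergent"): all field sums
`x ↦ φ(r − x)`, `r ∈ ℝᵈ`, are summable over `X` (for real series: absolutely convergent).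
[cite: Suto2006, §2 Definition (GSC), second form] [cite: Suto2011, Definition 7.1] -/
def IsGSC (φ : EuclideanSpace ℝ (Fin d) → ℝ) (X : Set (EuclideanSpace ℝ (Fin d))) : Prop :=
  (∀ r : EuclideanSpace ℝ (Fin d), Summable fun x : X => φ (r - x)) ∧
    ∀ (N : ℕ) (xf : Fin N → EuclideanSpace ℝ (Fin d)), Function.Injective xf → Set.range xf ⊆ X →
      ∀ R : Fin N → EuclideanSpace ℝ (Fin d),
        energy φ xf + interaction φ xf (X \ Set.range xf) ≤
          energy φ R + interaction φ R (X \ Set.range xf)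

/-- **Sütő's interaction** defined from its Fourier transform: `φ = 𝓕⁻¹ψ` (real part), in
Mathlib's convention `𝓕⁻¹ψ(r) = ∫ ψ(w) e^{2πi⟨w, r⟩} dw`; with `ψ(w) = φ̂(2πw)` this is the
printed `φ(r) = (2π)^{-d} ∫ φ̂(k) e^{ik·r} dk` (for even real `ψ` the integral is real).
[cite: Suto2006, §2 THEOREM (i) (definition of φ)] -/
def potential (ψ : EuclideanSpace ℝ (Fin d) → ℝ) (r : EuclideanSpace ℝ (Fin d)) : ℝ :=
  ((𝓕⁻ fun w : EuclideanSpace ℝ (Fin d) => (ψ w : ℂ)) r).re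

/-- **Strong temperedness** (sufficient form): `|φ(r)| ≤ C‖r‖^{-(d+η)}` for `‖r‖ > r₀`, for some
positive numbers `C, η, r₀` ("where `C`, `η` and `r'` are some positive numbers").
[cite: Suto2006, §2 Remark 6] [cite: Suto2011, (2.2)] -/
def IsStronglyTempered (φ : EuclideanSpace ℝ (Fin d) → ℝ) : Prop :=
  ∃ C η r₀ : ℝ, 0 < C ∧ 0 < η ∧ 0 < r₀ ∧
    ∀ r : EuclideanSpace ℝ (Fin d), r₀ < ‖r‖ → |φ r| ≤ C * ‖r‖ ^ (-((d : ℝ) + η))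

/-- **The scope of the barrier (technique class, as a definition)**: Sütő's hypotheses (1)–(4) on
the Fourier side `ψ` (`ψ(w) = φ̂(2πw)`), in the sub-class where `ψ` is continuous everywhere and
`φ = 𝓕⁻¹ψ` is strongly tempered (Remark 6: e.g. `ψ ∈ C³`), with cut-off `κ = K₀/2π > 0`:
`ψ ≥ 0`, `ψ` even, `ψ(w) = 0` for `‖w‖ > κ`. The typical member in `d = 3` has
`φ(r) ∼ cos(K₀r)/r⁴` (Sütő 2005, abstract). [cite: Suto2006, §2 THEOREM, hypotheses (1)–(4) and Remark 6]
[cite: SutoPRL2005, THEOREM and abstract] -/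
structure IsAdmissible (κ : ℝ) (ψ : EuclideanSpace ℝ (Fin d) → ℝ) : Prop where
  pos : 0 < κ
  continuous : Continuous ψ
  nonneg : ∀ w, 0 ≤ ψ w
  even : ∀ w, ψ (-w) = ψ w
  eq_zero : ∀ w, κ < ‖w‖ → ψ w = 0
  tempered : IsStronglyTempered (potential ψ)

/-- **The reciprocal-lattice condition `q_{B^*} ≥ K₀`** in Mathlib's convention: every non-zero
`w` of the dual lattice `Literature.Lattice.dualLattice B = {w | ⟨w, g⟩ ∈ ℤ for all g ∈ B}` (i.e.
`2πw ∈ B^*`, where `a_α · b_β = 2πδ_{αβ}`) has `‖w‖ ≥ κ = K₀/2π`.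
[cite: Suto2006, §2 (B^*, q_{B^*}) and THEOREM (i)] -/
def DualVectorsAtLeast (κ : ℝ) (B : Submodule ℤ (EuclideanSpace ℝ (Fin d))) : Prop :=
  ∀ w ∈ Literature.Algebra.EuclideanLattices.dualLattice B, w ≠ 0 → κ ≤ ‖w‖

/-- `q_{B^*} ≥ K₀` is the statement `κ ≤ λ₁(B^*)` about the minimum distance
(`Literature.Algebra.EuclideanLattices.minNorm`) of the dual lattice, whenever the dual lattice is non-zero (for `B^* = ⊥`
the tree's `minNorm ⊥ = 0` is a junk value while `DualVectorsAtLeast κ ⊥`-dual is vacuous).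
[cite: Suto2006, §2 ("q_{B^*} denoting the nearest neighbor distance in B^*")] -/
theorem dualVectorsAtLeast_iff_le_minNorm {κ : ℝ} {B : Submodule ℤ (EuclideanSpace ℝ (Fin d))}
    (hB : Literature.Algebra.EuclideanLattices.dualLattice B ≠ ⊥) :
    DualVectorsAtLeast κ B ↔ κ ≤ Literature.Algebra.EuclideanLattices.minNorm (Literature.Algebra.EuclideanLattices.dualLattice B) := by
  have hne : ((‖·‖) '' {x : EuclideanSpace ℝ (Fin d) |
      x ∈ Literature.Algebra.EuclideanLattices.dualLattice B ∧ x ≠ 0}).Nonempty := by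
    obtain ⟨x, hx, hx0⟩ := (Submodule.ne_bot_iff _).mp hB
    exact ⟨‖x‖, x, ⟨hx, hx0⟩, rfl⟩
  have hbdd : BddBelow ((‖·‖) '' {x : EuclideanSpace ℝ (Fin d) |
      x ∈ Literature.Algebra.EuclideanLattices.dualLattice B ∧ x ≠ 0}) :=
    ⟨0, by rintro _ ⟨x, -, rfl⟩; exact norm_nonneg x⟩
  rw [Literature.Algebra.EuclideanLattices.minNorm, le_csInf_iff hbdd hne]
  constructor
  · rintro h _ ⟨x, ⟨hx, hx0⟩, rfl⟩
    exact h x hx hx0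
  · intro h w hw hw0
    exact h ‖w‖ ⟨w, ⟨hw, hw0⟩, rfl⟩

end Suto

open Suto

/-- **Barrier `SutoDegenerateGroundStates` (Sütő 2006, THEOREM (i); announced 2005): for a
Fourier-positive, band-limited pair interaction every union of sufficiently dense Bravais
lattices, arbitrarily translated, is a ground state configuration — in every dimension.**
For `d ≥ 1`, `κ > 0` and `ψ : ℝᵈ → ℝ` admissible (`Suto.IsAdmissible`: continuous, `≥ 0`, even,
vanishing for `‖w‖ > κ`, with `φ = 𝓕⁻¹ψ` strongly tempered), for all periodic configurations
`P₁, …, P_J` of the tree (`Literature.StatMech.PeriodicConfiguration d`: full-rank lattice `B_j` plus a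
finite motif, i.e. the `B_j`-periodic configurations `∪_i (B_j + y_{ji})` of the source) whose
lattices have all non-zero dual vectors of norm `≥ κ` (printed: `q_{B_j^*} ≥ K₀`) and whose
point sets are pairwise disjoint, the union `X = ⋃_j P_j.points` is a GSC of `φ`
(`Suto.IsGSC`: stable against every particle-number preserving finite modification). Sütő 2005,
THEOREM (i): "Let `B` be a Bravais lattice with `q_{B^*} ≥ K₀`. Then every `B`-periodic
configuration `X` is a GSC … Any union of GSCs of the above type is a GSC (that can be
aperiodic)"; Sütő 2006, THEOREM (i): `X = ∪_{j=1}^J (B_j + y_j)` "is a GSC of `φ` for arbitrary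
translations `y_j`". Printed complement, not formalised: `X` is also a `μ`GSC for
`μ = ρ(X)φ̂(0) − ½φ(0)`, `e(X) = ½ρ[ρφ̂(0) − φ(0)]` is the minimal energy density among unions
of periodic configurations of density `ρ`, such GSCs "exist in a semi-infinite density interval
`[ρ_d, ∞)`" (`q_{B^*} ≥ K₀` forces `ρ(B) ≥ ρ_d`; `ρ₃ = K₀³/8√2π³`, where bcc is the unique
periodic GSC if `φ̂(k) > 0` for `0 < |k| < K₀`, Sütő 2005 (ii)), and "the simplest aperiodic GSCs,
unions of two incommensurate Bravais lattices, appear only if `ρ ≥ 2ρ_d`. For example, in 3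
dimensions at `2ρ₃` they are the unions of two bcc lattices rotated and possibly shifted with
respect to each other" (Remark 2).

BARRIER (D-0021; every clause is a citation, not an assessment)
* technique_class: potential-generic ground-state arguments in `d = 3` — any derivation of periodicity, or of uniqueness up to isometry, of infinite-volume ground state configurations AT PRESCRIBED DENSITY `ρ > ρ_d` OR PRESCRIBED CHEMICAL POTENTIAL (audit 2026-08-15, `scope_caveats` (d)) from hypotheses on the pair interaction that hold throughout `Suto.IsAdmissible` (read: that are met by some non-zero admissible `ψ` — `ψ = 0` is admissible, audit 2026-08-15): there `φ` "is continuous and all its derivatives exist … `φ(r)` is an entire function of `r`" [cite: Suto2006, §2 (before THEOREM)], "the interaction is stable if `φ̂(0) ≥ 0` and is superstable if `φ̂(0) > 0`" [cite: SutoPRL2005, after THEOREM], it is strongly tempered (`|φ| ≤ Cr^{-d-η}`, Remark 6) and has rotation invariant members "of asymptotic form `cos K₀r/r⁴`" [cite: SutoPRL2005, abstract] ("innocent looking RKKY-type interactions" [cite: SutoPRL2005, closing summary paragraph]); in particular Fourier-positivity (`φ̂ ≥ 0`) / `k`-space positivity arguments, which identify the minimal energy density `ε(ρ) = ½ρ[ρφ̂(0)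 − φ(0)]` exactly [cite: Suto2006, §2 THEOREM (i)–(ii)] [cite: SutoPRL2005, THEOREM (i) and the paragraph before it ("any structure making the rest vanish is a GSC")]
* blocks: the natural strengthening of `AtomisticToContinuum/Crystallization` from Lennard-Jones to a potential-generic statement "ground states of stable, smooth, fast-decaying pair interactions in `ℝ³` are periodic (crystalline) and essentially unique": in Sütő's class, for every density `ρ > ρ_d` "the GSC is non-unique and the degeneracy is continuous: Any periodic configuration of density `ρ` with all reciprocal lattice vectors not smaller than `K₀`, and any union of such configurations, is a GSC" [cite: SutoPRL2005, abstract and THEOREM (i)–(ii)], aperiodic unions included [cite: Suto2006, §2 THEOREM (i) and Remarks 2–3]; "the potentials are very delocalized resulting in a significantly degenerate behavior of the ground states: every periodic configuration with a sufficiently high density is a minimizer" [cite: FlatleyTheil2015, §1 (Introduction, fifth paragraph)]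
* because: for `φ̂ ≥ 0` supported in `|k| ≤ K₀`, `∑_{i,j} φ(r_i − r_j) = (2π)^{-d} ∫_{|k|<K₀} φ̂(k)|∑_j e^{ik·r_j}|² dk ≥ 0`; with periodic boundary conditions the `k = 0` term is structure-independent and "any structure making the rest vanish is a GSC. But that is exactly what periodic structures accomplish, provided their shortest reciprocal lattice vector is outside the `|k| = K₀` sphere" [cite: SutoPRL2005, paragraph before THEOREM, and proof of (i)]; by Poisson summation `∑_{R ∈ B} φ(r + R) = ρ(B) ∑_{K ∈ B^*} φ̂(K)e^{iK·r} = ρ(B)φ̂(0)`, so each such lattice creates a force-free (constant) field, "This implies that the union of GSCs is also a GSC that can be aperiodic" [cite: SutoPRL2005, end of proof of (i)] [cite: Suto2006, §2 LEMMA and Remark 3]; "We can understand this proliferation of GSC as a consequence of the insensitivity of the interaction to details on a length scale shorter than `K₀^{-1}`" [cite: SutoPRL2005, introduction]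
* evasions_known: (i) add a repulsive core `ψ_rep ≥ 0` of range `r₀ ≤ γ_d/K₀` (`γ₃ = √6π`): Bravais lattices with `r_B ≥ r₀`, `q_{B^*} ≥ K₀` stay GSCs of `φ + ψ_rep`, now in bounded density intervals `[ρ_d, ρ_d']`, and, provided `φ̂ > 0` for `k < K₀` and `ψ_rep > 0` for `r < r₀`, "at `ρ = √2/r₀³` the unique GSC is the fcc lattice" [cite: Suto2006, §2 THEOREM (iii) and Remark 7]; (ii) at the threshold density `ρ_d` itself the periodic GSC is unique (bcc for `d = 3`) when `φ̂(k) > 0` for `0 < |k| < K₀` [cite: SutoPRL2005, THEOREM (ii)]; (iii) leave the class: "localized potentials where the strength of the interaction between pairs of particles decays with an inverse power law", for which Flatley–Theil prove that the minimum energy per particle converges to that of the fcc lattice (pair plus three-body term) [cite: FlatleyTheil2015, §1 and Theorem 1.1]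
* scope_caveats: (a) the theorem is about infinite-volume GSCs (local stability at fixed particle number, i.e. fixed density `ρ ≥ ρ_d`, or fixed chemical potential), not about the zero-pressure finite-`N` minimisers `E(N)` of `Literature.MathematicalPhysics.StatisticalMechanics.IsCrystallizing` / `HasPeriodicGroundStateEnergy`, and it is "not predictive below a dimension-dependent density `ρ_d`" [cite: SutoPRL2005, introduction]; (b) the Lennard-Jones potential is not in the class (`V_LJ` is unbounded at `0` and `V̂_LJ` is neither non-negative nor compactly supported), so nothing here refutes `Crystallization` itself — the barrier concerns potential-generic methods and the generic strengthening; (c) formalised here is only the GSC clause of (i), in the sub-class `IsAdmissible` (continuous `ψ`, strongly tempered `φ`) and for disjoint translates; energy-density minimality, the `μ`GSC clause, the interval `[ρ_d, ∞)` and the aperiodicity of incommensurate unions are quoted, not formalised; (d) NARROWED (audit 2026-08-15, `SutoDegenerateGroundStatesNarrow`): "ground states" in `blocks` is to be read at prescribed density `ρ > ρ_d` (canonical GSC), prescribed `μ` (`μ`GSC), or `μ = 0` when `φ(0)/2φ̂(0) > ρ_d` ("globally stable" [cite: Suto2006, §2 Remark 5]; "a continuous family of inequivalent `μ`GSC at `μ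 = 0`" [cite: SutoPRL2005, Examples]); at ZERO PRESSURE (minimal energy per particle, the `E(N)` problem of `Crystallization`) the family's energy per particle `ε(ρ)/ρ = ½[ρφ̂(0) − φ(0)]` [cite: Suto2006, §2 THEOREM (i)] is strictly increasing in `ρ` for superstable members (`φ̂(0) > 0` [cite: SutoPRL2005, after THEOREM]), its minimum over the family being the threshold lattice alone ("At `ρ_d` there is a unique periodic GSC which is … the bcc lattice" [cite: SutoPRL2005, abstract and THEOREM (ii)]) — no degenerate member is a zero-pressure ground state, and below `ρ_d` the theorem is "not predictive" [cite: SutoPRL2005, introduction]; (e) only on the non-superstable edge `φ̂(0) = 0` ("even if `φ̂(0) = 0` and thus `φ` is not superstable. In the latter case `μ = −½φ(0)`, independently of the density" [cite: Suto2006, §2 Remark 4]) does every member of the family attain the universal bound `U(R) ≥ −φ(0)N_R/2` [cite: SutoPRL2005, Definitions and notations (before THEOREM)] on the energy per particle, i.e. is the zero-pressure problem itself degenerate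
* status: established (Sütő 2005 announcement with proof sketch; Sütő 2006 full statement and proof, Phys. Rev. B; restated and used in Sütő 2011, Comm. Math. Phys., §7–§9; no dissent found); DISCHARGED in Lean (`SutoDegenerateGroundStates_holds`); NARROWED by the 2026-08-15 audit (`SutoDegenerateGroundStatesNarrow`, proved)

[cite: Suto2006, §2 THEOREM (i)] [cite: SutoPRL2005, THEOREM (i)] -/
def SutoDegenerateGroundStates : Prop :=
  ∀ (d : ℕ), 1 ≤ d → ∀ (κ : ℝ) (ψ : EuclideanSpace ℝ (Fin d) → ℝ), IsAdmissible κ ψ →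
    ∀ (J : ℕ) (P : Fin J → Literature.MathematicalPhysics.StatisticalMechanics.PeriodicConfiguration d),
      (∀ j, DualVectorsAtLeast κ (P j).lattice) →
      Pairwise (fun i j => Disjoint (P i).points (P j).points) →
      IsGSC (potential ψ) (⋃ j, (P j).points)

/-! ### API: the one-lattice case -/

/-- **Every sufficiently dense periodic configuration is a GSC** (case `J = 1` of the fact; the
2005 form of THEOREM (i): "Let `B` be a Bravais lattice with `q_{B^*} ≥ K₀`. Then every
`B`-periodic configuration `X` is a GSC"): lattice `B` with arbitrary finite motif, in
particular every translate `y + B`. [cite: SutoPRL2005, THEOREM (i)] -/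
theorem SutoDegenerateGroundStates.periodic (h : SutoDegenerateGroundStates) {d : ℕ} (hd : 1 ≤ d)
    {κ : ℝ} {ψ : EuclideanSpace ℝ (Fin d) → ℝ} (hψ : IsAdmissible κ ψ)
    (P : Literature.MathematicalPhysics.StatisticalMechanics.PeriodicConfiguration d) (hP : DualVectorsAtLeast κ P.lattice) :
    IsGSC (potential ψ) P.points := by
  have := h d hd κ ψ hψ 1 (fun _ => P) (fun _ => hP) Subsingleton.pairwise
  simpa only [Set.iUnion_const] using this

/-- A Bravais lattice `B` translated by `y` (motif `{y}`) as a periodic configuration of the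
tree (`Literature.MathematicalPhysics.StatisticalMechanics.PeriodicConfiguration`: lattice + finite motif). [folklore] -/
def bravaisConfiguration {d : ℕ} (B : Submodule ℤ (EuclideanSpace ℝ (Fin d))) [DiscreteTopology B]
    [IsZLattice ℝ B] (y : EuclideanSpace ℝ (Fin d)) : Literature.MathematicalPhysics.StatisticalMechanics.PeriodicConfiguration d where
  lattice := B
  discrete := inferInstance
  isZLattice := inferInstance
  motif := {y}
  motif_nonempty := Finset.singleton_nonempty y
  eq_of_sub_mem := by
    intro x hx x' hx' _
    rw [Finset.mem_singleton] at hx hx'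
    rw [hx, hx']

/-- The point set of `bravaisConfiguration B y` is the translate `y + B`. [folklore] -/
theorem bravaisConfiguration_points {d : ℕ} (B : Submodule ℤ (EuclideanSpace ℝ (Fin d)))
    [DiscreteTopology B] [IsZLattice ℝ B] (y : EuclideanSpace ℝ (Fin d)) :
    (bravaisConfiguration B y).points = y +ᵥ (B : Set (EuclideanSpace ℝ (Fin d))) := by
  ext z
  simp only [Literature.MathematicalPhysics.StatisticalMechanics.PeriodicConfiguration.points, bravaisConfiguration, Finset.mem_singleton,
    exists_eq_left, Set.mem_setOf_eq]
  constructor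
  · rintro ⟨g, hg, rfl⟩
    exact ⟨g, hg, rfl⟩
  · rintro ⟨g, hg, rfl⟩
    exact ⟨g, hg, rfl⟩

/-- **Every translate of a sufficiently dense Bravais lattice is a GSC** ("for arbitrary
translations `y_j`"): the translates `y + B`, `y ∈ ℝᵈ`, form a continuum of ground state
configurations of one and the same interaction. [cite: Suto2006, §2 THEOREM (i)] -/
theorem SutoDegenerateGroundStates.translate (h : SutoDegenerateGroundStates) {d : ℕ} (hd : 1 ≤ d)
    {κ : ℝ} {ψ : EuclideanSpace ℝ (Fin d) → ℝ} (hψ : IsAdmissible κ ψ)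
    (B : Submodule ℤ (EuclideanSpace ℝ (Fin d))) [DiscreteTopology B] [IsZLattice ℝ B]
    (hB : DualVectorsAtLeast κ B) (y : EuclideanSpace ℝ (Fin d)) :
    IsGSC (potential ψ) (y +ᵥ (B : Set (EuclideanSpace ℝ (Fin d)))) := by
  rw [← bravaisConfiguration_points]
  exact h.periodic hd hψ (bravaisConfiguration B y) hB

/-! ### The simple cubic lattice `cℤ³` satisfies the reciprocal condition for `c ≤ 1/κ` -/

/-- The basis `(c e₁, c e₂, c e₃)` of `ℝ³`, `c` a unit. [folklore] -/
def cubicBasis (c : ℝˣ) : Module.Basis (Fin 3) ℝ (EuclideanSpace ℝ (Fin 3)) :=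
  (EuclideanSpace.basisFun (Fin 3) ℝ).toBasis.unitsSMul fun _ => c

/-- `cubicBasis c i = c • eᵢ`. [folklore] -/
theorem cubicBasis_apply (c : ℝˣ) (i : Fin 3) :
    cubicBasis c i = (c : ℝ) • EuclideanSpace.single i (1 : ℝ) := by
  classical
  rw [cubicBasis, Module.Basis.unitsSMul_apply, OrthonormalBasis.coe_toBasis,
    EuclideanSpace.basisFun_apply, Units.smul_def]

/-- **The simple cubic lattice** `cℤ³ = {c n : n ∈ ℤ³}` as the `ℤ`-span of `(c e₁, c e₂, c e₃)`;
Mathlib supplies `DiscreteTopology` and `IsZLattice ℝ` for spans of bases. (Sütő 2005 (ii): sc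
is a GSC at and above `ρ_sc = (1/8)(K₀/π)³`.) [cite: SutoPRL2005, THEOREM (ii)] -/
def cubicLattice (c : ℝˣ) : Submodule ℤ (EuclideanSpace ℝ (Fin 3)) :=
  Submodule.span ℤ (Set.range (cubicBasis c))

/-- `cℤ³` is discrete (Mathlib: spans of bases are). [folklore] -/
instance instDiscreteTopologyCubicLattice (c : ℝˣ) : DiscreteTopology (cubicLattice c) := by
  unfold cubicLattice; infer_instance

/-- `cℤ³` has full rank (Mathlib: spans of bases are `ℤ`-lattices). [folklore] -/
instance instIsZLatticeCubicLattice (c : ℝˣ) : IsZLattice ℝ (cubicLattice c) := by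
  unfold cubicLattice; infer_instance

/-- The generators `c eᵢ` belong to `cℤ³`. [folklore] -/
theorem smul_single_mem_cubicLattice (c : ℝˣ) (i : Fin 3) :
    (c : ℝ) • EuclideanSpace.single i (1 : ℝ) ∈ cubicLattice c := by
  rw [← cubicBasis_apply]
  exact Submodule.subset_span (Set.mem_range_self i)

/-- **`cℤ³` is admissible for cut-off `κ` when `0 < c` and `cκ ≤ 1`**: a vector `w` with
`⟨w, c eᵢ⟩ = n_i ∈ ℤ` for `i = 1, 2, 3` has coordinates `n_i/c`, so `w ≠ 0` forces some
`|n_i| ≥ 1` and `‖w‖ ≥ |w_i| ≥ 1/c ≥ κ` (the dual lattice of `cℤ³` is `c⁻¹ℤ³`; printed: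
`q_{sc^*} = 2π/c ≥ K₀` iff `ρ = c⁻³ ≥ ρ_sc = (K₀/2π)³`). [cite: SutoPRL2005, THEOREM (ii) (ρ_sc)] -/
theorem dualVectorsAtLeast_cubicLattice {κ : ℝ} {c : ℝˣ} (hc : 0 < (c : ℝ))
    (hcκ : (c : ℝ) * κ ≤ 1) : DualVectorsAtLeast κ (cubicLattice c) := by
  intro w hw hw0
  rw [Literature.Algebra.EuclideanLattices.mem_dualLattice] at hw
  -- some coordinate of `w` is non-zero
  have hex : ∃ i, w i ≠ 0 := by
    by_contra hall
    push Not at hall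
    exact hw0 (PiLp.ext fun i => by simpa using hall i)
  obtain ⟨i, hi⟩ := hex
  obtain ⟨n, hn⟩ := hw _ (smul_single_mem_cubicLattice c i)
  -- `⟨w, c eᵢ⟩ = c w_i`
  have hinner : ⟪w, (c : ℝ) • EuclideanSpace.single i (1 : ℝ)⟫ = (c : ℝ) * w i := by
    rw [real_inner_smul_right, EuclideanSpace.inner_single_right]
    simp
  rw [hinner] at hn
  replace hn : (c : ℝ) * w i = n := hn.symm
  have hn0 : n ≠ 0 := by
    rintro rfl
    simp only [Int.cast_zero, mul_eq_zero] at hn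
    rcases hn with h | h
    · exact (ne_of_gt hc) h
    · exact hi h
  have hn1 : (1 : ℝ) ≤ |(n : ℝ)| := by
    rw [← Int.cast_abs]; exact_mod_cast Int.one_le_abs hn0
  have hwi : 1 ≤ (c : ℝ) * |w i| := by
    calc (1 : ℝ) ≤ |(n : ℝ)| := hn1
      _ = |(c : ℝ) * w i| := by rw [hn]
      _ = (c : ℝ) * |w i| := by rw [abs_mul, abs_of_pos hc]
  have hcoord : |w i| ≤ ‖w‖ := by
    have := PiLp.norm_apply_le w i
    simpa using this
  -- `κ ≤ 1/c ≤ |w i| ≤ ‖w‖`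
  have hκ : κ * (c : ℝ) ≤ (c : ℝ) * |w i| := by nlinarith
  have : κ ≤ |w i| := le_of_mul_le_mul_right (by nlinarith [hκ]) hc
  exact this.trans hcoord

/-- **A two-parameter continuum of ground states in `ℝ³`** (given the fact): for every
admissible `(κ, ψ)`, every `0 < c ≤ κ⁻¹` and every `y ∈ ℝ³`, the translated simple cubic lattice
`y + cℤ³` is a ground state configuration of `φ = 𝓕⁻¹ψ` — compressing (`c ↓`) or translating
any of them gives another ("The degeneracy increases with the density in the sense that
compressing any GSC results in a GSC of a higher density that can further be deformed").
[cite: SutoPRL2005, introduction and THEOREM (i)–(ii)] -/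
theorem SutoDegenerateGroundStates.cubic (h : SutoDegenerateGroundStates) {κ : ℝ}
    {ψ : EuclideanSpace ℝ (Fin 3) → ℝ} (hψ : IsAdmissible κ ψ) {c : ℝˣ} (hc : 0 < (c : ℝ))
    (hcκ : (c : ℝ) * κ ≤ 1) (y : EuclideanSpace ℝ (Fin 3)) :
    IsGSC (potential ψ) (y +ᵥ (cubicLattice c : Set (EuclideanSpace ℝ (Fin 3)))) :=
  h.translate (by norm_num) hψ (cubicLattice c) (dualVectorsAtLeast_cubicLattice hc hcκ) y

end Literature.Barriers.AtomisticToContinuum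

end
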